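import Summits.CriticalPhenomena.CardyFormulaZ2.Theses.CardyMagicRigidity
import Literature.Probability.Percolation.FKLoopNestingMagicFormula
import HarnessLib

/-!
# `MagicFormulaZ2` (stmt-CriticalPhenomena-4834) from DKLM 2026, Corollary 10 — the conditional close

Route `CardyMagicRigidity` of `CriticalPhenomena/CardyFormulaZ2`. Its support item `MagicFormulaZ2`
(rank 2, the route's INPUT FACT) reads: for every measurable `f : ℂ → ℝ` with `|f| ≤ C`, `f = 0`
off `B̄(0, R)` and `∫ f = 0`, the Bernoulli-`1/2` bond-`ℤ²` nesting transform
`E[∏_u 2cos(∫_{W(u,·) ≠ 0} f + π/3)]`, the product over all interface loops `u` of `δℤ²` (both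
types of `bondLoopConfig δ 0`), tends, as `δ → 0⁺`, to `exp((3/4π²) ∫∫ log ‖x - y‖ f(x) f(y) dy dx)`.
This is, verbatim, the `q = 1` / density / `P = bondPercolation (zdGraph 2) half` special case of
the Literature NAMED FACT `Literature.Probability.Percolation.dklm2026_corollary10`
(Duminil-Copin–Kozlowski–Lammers–Manolescu, arXiv:2603.06268 (2026), Cor. 10: `q ∈ [1, 4]`, every
free random-cluster limit at the self-dual point, every finite-Dirichlet-energy generalised test
function), through the tree's PROVED companions of the fact: densities `f · Leb` as above are
finite-energy generalised test functions (`isGeneralisedTestFunction_withDensityᵥ`,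
`hasFiniteDirichletEnergy_withDensityᵥ`, `loopNestingWeight_withDensityᵥ`,
`dirichletEnergy_withDensityᵥ` of `FKLoopNestingTestFunctions` / `FKLoopNestingDensityLimit`), the
`q = 1` constants `cos_μ = 2cos(· + π/3)`, `σ² = 3/π` (`cosMu_one`, `dklmSigmaSq_one`), and
Bernoulli-`1/2` bond percolation on `ℤ²` being the free FK(1) limit at `p = 1/2`
(`isFreeRandomClusterLimit_bondPercolation_half`, `FKLoopNestingPercolationBridge`).

What is landed here (both CONDITIONAL — trust base: the cited, unrefereed Cor. 10, whose public
proof rests on DKLM Thm. 8 and on the infinite-volume BKW identity (3.2) deferred to the authors'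
unreleased companion paper; see the docstring of `dklm2026_corollary10` and
`Literature.Probability.Percolation.dklm2026_corollary10_of_gaussianLimit`):

* `magicFormulaZ2_of_dklm2026_q_one` — `MagicFormulaZ2` from the `q = 1` INSTANCE of the fact only
  (all free random-cluster limits `P` at `(p, q) = (1/2, 1)`, all finite-energy generalised test
  functions, constants unevaluated): the smallest Literature-shaped hypothesis, so that a discharge
  of the percolation case of Cor. 10 alone (six-vertex point `c = √3`, `Δ = -1/2`) closes the item;
* `magicFormulaZ2_of_dklm2026` — `MagicFormulaZ2` from the fact as vendored (`q ∈ [1, 4]`), the term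
  to feed to the route's deciding theorem `closes` (`h2 := magicFormulaZ2_of_dklm2026 h`).

No unconditional proof is attempted: the item IS the fact's special case and the fact is a 2026
research theorem (XL). The item therefore stays open, blocked on `dklm2026_corollary10`.

References: H. Duminil-Copin, K. K. Kozlowski, P. Lammers, I. Manolescu, arXiv:2603.06268 (2026),
§3.2 and Cor. 10 (p. 13); G. Grimmett, *The Random-Cluster Model* (2006), §1.2, (6.9).
-/

noncomputable section

open MeasureTheory Set Filter
open scoped Real Topology

namespace Summit.CriticalPhenomena.CardyFormulaZ2.Theorems

open Literature.Probability.Percolation Literature.Probability.LatticeModels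
  Literature.Probability.RandomPlanarGeometry

/-- **`MagicFormulaZ2` from DKLM Cor. 10 at `q = 1` alone** (conditional close of item
stmt-CriticalPhenomena-4834 on the percolation instance of the named fact
`Literature.Probability.Percolation.dklm2026_corollary10`): if for every free random-cluster limit
`P` at `(p, q) = (1/2, 1)` and every finite-energy generalised test function `φ`
`E_P[∏_u cos_μ(φ(int u))] → exp(-½ σ²(1) Σ(φ))` as `δ → 0⁺`, then the route decl `MagicFormulaZ2`
holds — specialise to `P = bondPercolation (zdGraph 2) half`
(`isFreeRandomClusterLimit_bondPercolation_half`) and `φ = f · Leb`, and evaluate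
`cos_μ = 2cos(· + π/3)`, `σ² = 3/π`, `-½ σ² · (-1/2π) = 3/(4π²)`.
[cite: DuminilCopinKozlowskiLammersManolescu2026, Cor. 10 (q = 1)] -/
theorem magicFormulaZ2_of_dklm2026_q_one
    (h : ∀ P : Measure (BondConfig (Site 2)), IsFreeRandomClusterLimit (1 / 2) 1 P →
      ∀ φ : SignedMeasure ℂ, IsGeneralisedTestFunction φ → HasFiniteDirichletEnergy φ →
        Tendsto (fun δ : ℝ ↦ ∫ ω, loopNestingWeight 1 φ δ ω ∂P) (𝓝[>] 0)
          (𝓝 (Real.exp (-(dklmSigmaSq 1 / 2) * dirichletEnergy φ)))) :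
    Summit.CriticalPhenomena.CardyFormulaZ2.Theses.CardyMagicRigidity.MagicFormulaZ2 := by
  intro f R C hf hC hR h0
  have hfi := integrable_of_abs_le_of_eq_zero hf hC hR
  have h1 := h _ isFreeRandomClusterLimit_bondPercolation_half _
    (isGeneralisedTestFunction_withDensityᵥ hf hfi hR h0)
    (hasFiniteDirichletEnergy_withDensityᵥ hf hC hR)
  simp only [loopNestingWeight_withDensityᵥ 1 hfi, dirichletEnergy_withDensityᵥ hf hC hR, cosMu_one,
    dklmSigmaSq_one] at h1
  convert h1 using 3
  field_simp
  ring

/-- **`MagicFormulaZ2` from the named fact DKLM 2026, Cor. 10** (conditional close of item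
stmt-CriticalPhenomena-4834; the term the route's deciding theorem `closes` consumes as its
hypothesis `h2`): the route decl is the `q = 1`, density, Bernoulli-`1/2` special case of
`Literature.Probability.Percolation.dklm2026_corollary10`. Trust base = that cited, unrefereed
fact. [cite: DuminilCopinKozlowskiLammersManolescu2026, Cor. 10 (q = 1)] -/
theorem magicFormulaZ2_of_dklm2026 (h : dklm2026_corollary10) :
    Summit.CriticalPhenomena.CardyFormulaZ2.Theses.CardyMagicRigidity.MagicFormulaZ2 :=
  magicFormulaZ2_of_dklm2026_q_one fun P hP ↦
    h 1 ⟨le_rfl, by norm_num⟩ P (by rwa [rcSelfDualPoint_one])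

/-- Consistency check: the same term is the Literature one-liner
`dklm2026_corollary10.magicFormulaZ2_shape` (`FKLoopNestingMagicFormula`). -/
example (h : dklm2026_corollary10) :
    Summit.CriticalPhenomena.CardyFormulaZ2.Theses.CardyMagicRigidity.MagicFormulaZ2 :=
  h.magicFormulaZ2_shape

end Summit.CriticalPhenomena.CardyFormulaZ2.Theorems

end
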